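import Summits.BirchSwinnertonDyer.Rank1Residual.AdditivePotMult.TwistSupplyX4
import HarnessLib

/-!
# X3♯(M) / X4(M): the quadratic fields of the relocation are RAMIFIED at `p` — class theorems with the
# hypothesis "the `p`-part of BSD for `E` over every quadratic field ramified at `p`"

HONEST FRAMING (cell `b2b-bsdres`, run/shared/lean/b2b/bsd-rank1-residual/, verbatim in every
file): the goal of the cell is to DELETE the COMBINATION-SHAPED residual classes of the
Birch–Swinnerton-Dyer formula for ALL analytic-rank `≤ 1` elliptic curves over `ℚ` — "full BSD
formula for every rank `≤ 1` curve in class `C`" assembled STRICTLY from published theorems — so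
that the rank-`≤ 1` remainder becomes exactly the CONSTRUCTION-SHAPED classes, which are TYPED
(missing-input `Prop`s), NOT attempted. This is not "finishing BSD". Sub-cell
`b2b-bsdres-additive-p1` (CLASS-OWNERS row "X3/X4 additive — pot. multiplicative / X3♯(M)"),
generation 3; research route, no claim beyond the stated sub-classes; X3♯(M), X4(M) REMAIN
CONSTRUCTION-SHAPED.

Theorems only; no definition, no new named fact. The class theorems of `TwistSupply.lean`,
`TwistSupplyRam.lean`, `TwistSupplyX4.lean` ask the over-`K` input for the quadratic fields `K` whose
twist `E^{(d_K)}` is multiplicative at `p`. This file proves the remark made in their docstrings —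
such `K` are RAMIFIED at `p` — and restates the class theorems with the plainer hypothesis
"`MissingPPartOverCAt (W.baseChange K) p` for every quadratic field `K` with `p ∣ d_K`":

* `dvd_discr_of_mult_twist` — if `E` is not multiplicative at the odd prime `p` but a model of
  `E^{(d_K)}` is, then `p ∣ d_K` (else `E ≅ (E^{(d_K)})^{(d_K)}` would be multiplicative at `p` by the
  X2 owner's transport along a twist unramified at `p`).
* `bsdp_of_classX3M_of_forall_ramified`, `bsdp_of_classX4M_of_ram_of_forall_ramified`,
  `bsdp_of_classX4M_of_forall_ramified` — the class theorems with that hypothesis.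
-/

noncomputable section

open scoped Classical

open WeierstrassCurve Literature.NumberTheory.EllipticCurves
  Literature.NumberTheory.EllipticCurves.ModularForms
  Literature.NumberTheory.EllipticCurves.Rank1Residual
  Literature.NumberTheory.EllipticCurves.Rank1Residual.Typed
  Literature.NumberTheory.EllipticCurves.GreenbergVatsal2000
  Literature.NumberTheory.EllipticCurves.Wuthrich2014
  Literature.NumberTheory.EllipticCurves.SteinWuthrich2013

namespace Summit.BirchSwinnertonDyer.Rank1Residual.AdditivePotMult

variable {W : WeierstrassCurve ℚ} [W.IsElliptic] {p : ℕ} [Fact p.Prime]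

/-! ### §1 The fields of the relocation are ramified at `p` -/

/-- **A quadratic field whose twist is `p`-multiplicative while `E` is not is ramified at `p`.** Let
`p` be odd, `E/ℚ` (any model `W`) NOT multiplicative at `p`, `K` a number field and `Wd` a globally
minimal model of `E^{(d_K)}` which IS multiplicative at `p`. Then `p ∣ d_K`: otherwise the twist by
`d_K` is unramified at `p`, and `E ≅ (E^{(d_K)})^{(d_K)}` (`exists_variableChange_quadraticTwist_mul_sq`,
`exists_variableChange_quadraticTwist_one`) would be multiplicative at `p` by the X2 owner's
`hasMultiplicativeReductionAtPrime_of_smul_eq_quadraticTwist`. [folklore] -/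
theorem dvd_discr_of_mult_twist (hW : ¬ Mult W p) (hp2 : p ≠ 2) (K : Type) [Field K] [NumberField K]
    (Wd : WeierstrassCurve ℚ) [Wd.IsElliptic] [Wd.IsGloballyMinimal]
    (hWd : ∃ C : VariableChange ℚ, C • W.quadraticTwist (NumberField.discr K : ℚ) = Wd)
    (hmult : Mult Wd p) : (p : ℤ) ∣ NumberField.discr K := by
  by_contra hpd
  set D : ℤ := NumberField.discr K with hD_def
  have hD : (D : ℚ) ≠ 0 := by exact_mod_cast NumberField.discr_ne_zero K
  obtain ⟨C₀, hC₀⟩ := hWd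
  -- `W` is a model of `Wd^{(D)} ≅ E^{(D²)} ≅ E`
  obtain ⟨C₄, hC₄⟩ := W.exists_variableChange_quadraticTwist_one
  obtain ⟨C₅, hC₅⟩ := W.exists_variableChange_quadraticTwist_mul_sq 1 (D : ℚ) hD
  have h3 : Wd.quadraticTwist (D : ℚ) =
      (⟨C₀.u, (D : ℚ) * C₀.r, 0, 0⟩ : VariableChange ℚ) • W.quadraticTwist ((D : ℚ) * D) := by
    rw [← hC₀, quadraticTwist_smul, quadraticTwist_quadraticTwist]
  have hmodel : ((⟨C₀.u, (D : ℚ) * C₀.r, 0, 0⟩ : VariableChange ℚ) * C₅ * C₄) • W =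
      Wd.quadraticTwist ((D : ℤ) : ℚ) := by
    rw [mul_smul, mul_smul, hC₄, hC₅, h3, one_mul, sq]
  exact hW (X2.hasMultiplicativeReductionAtPrime_of_smul_eq_quadraticTwist Wd W hmodel p hp2 hpd hmult)

/-! ### §2 The class theorems with the hypothesis "over every quadratic field ramified at `p`" -/

/-- **X3♯(M) ⇐ the `p`-part of BSD for `E` over every quadratic field ramified at `p`.** For
`(E,p) ∈ X3♯(M)` of analytic rank `≤ 1`: if `MissingPPartOverCAt (W.baseChange K) p` holds for every
quadratic field `K` with `p ∣ d_K`, then `BSD(E,p)` (binders as in `bsdp_of_classX3M`; the field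
produced by the twist supply is ramified at `p`, `dvd_discr_of_mult_twist`). [folklore] -/
theorem bsdp_of_classX3M_of_forall_ramified [W.IsGloballyMinimal]
    (hGV : lambdaMu_multiplicative_of_gvPar)
    (hWu : thm16_charIdeal_dvd_multiplicative_of_reducible)
    (hJs : thm61_splitMultiplicative) (hJn : thm61_nonsplitMultiplicative)
    (hHs : exists_isSplitMultCanonical) (hHn : exists_isMultCanonical)
    (hGZK : rank_eq_analyticRank_of_analyticRank_le_one) (hmod : hasEntireLFunction_rat)
    (hpar : nonempty_modularParametrizationData)
    (hMilneC : Milne1972.bsdQuotient_baseChange_quadratic_anyModel)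
    (hnf : exists_isNewformOf) (hHL : HoffsteinLuo1997_exists_twist_L_one_ne_zero)
    (hGS : ∀ (V : WeierstrassCurve ℚ) [V.IsElliptic] [V.IsGloballyMinimal],
      greenberg_stevens (W := V) (p := p))
    (hX : ClassX3M W p) (hr : W.analyticRank ≤ 1)
    (hK : ∀ (K : Type) [Field K] [NumberField K], Module.finrank ℚ K = 2 →
      (p : ℤ) ∣ NumberField.discr K → MissingPPartOverCAt (W.baseChange K) p) :
    BSDp W p :=
  bsdp_of_classX3M hGV hWu hJs hJn hHs hHn hGZK hmod hpar hMilneC hnf hHL hGS hX hr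
    fun K _ _ Wd _ _ h2 hWd hmult ↦
      hK K h2 (dvd_discr_of_mult_twist hX.potMult.not_mult hX.p_ne_two K Wd hWd hmult)

/-- **X4(M) ∧ (ram) ⇐ the `p`-part of BSD for `E` over every quadratic field ramified at `p`**
(binders as in `bsdp_of_classX4M_of_ram`). [folklore] -/
theorem bsdp_of_classX4M_of_ram_of_forall_ramified [W.IsGloballyMinimal]
    (hGZK : rank_eq_analyticRank_of_analyticRank_le_one) (hmod : hasEntireLFunction_rat)
    (hMilneC : Milne1972.bsdQuotient_baseChange_quadratic_anyModel)
    (hSk : Skinner2016.thmC_padicValRat_bsd_rank_zero)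
    (hnf : exists_isNewformOf) (hHL : HoffsteinLuo1997_exists_twist_L_one_ne_zero)
    (hX : ClassX4M W p) (hr : W.analyticRank ≤ 1) (hram : Ram W p)
    (hK : ∀ (K : Type) [Field K] [NumberField K], Module.finrank ℚ K = 2 →
      (p : ℤ) ∣ NumberField.discr K → MissingPPartOverCAt (W.baseChange K) p) :
    BSDp W p :=
  bsdp_of_classX4M_of_ram hGZK hmod hMilneC hSk hnf hHL hX hr hram
    fun K _ _ Wd _ _ h2 hWd hmult ↦
      hK K h2 (dvd_discr_of_mult_twist hX.potMult.not_mult hX.p_ne_two K Wd hWd hmult)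

/-- **X4(M), all pairs ⇐ the `p`-part of BSD for `E` over every quadratic field ramified at `p` +
x11a's rank-zero input** (binders as in `bsdp_of_classX4M`). [folklore] -/
theorem bsdp_of_classX4M_of_forall_ramified [W.IsGloballyMinimal]
    (hGZK : rank_eq_analyticRank_of_analyticRank_le_one) (hmod : hasEntireLFunction_rat)
    (hMilneC : Milne1972.bsdQuotient_baseChange_quadratic_anyModel)
    (hSk : Skinner2016.thmC_padicValRat_bsd_rank_zero) (hW : sha_dvd_analyticSha)
    (hnf : exists_isNewformOf) (hHL : HoffsteinLuo1997_exists_twist_L_one_ne_zero)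
    (hX : ClassX4M W p) (hr : W.analyticRank ≤ 1)
    (hK : ∀ (K : Type) [Field K] [NumberField K], Module.finrank ℚ K = 2 →
      (p : ℤ) ∣ NumberField.discr K → MissingPPartOverCAt (W.baseChange K) p)
    (hX11 : ∀ (V : WeierstrassCurve ℚ) [V.IsElliptic] [V.IsGloballyMinimal],
      V.analyticRank = 0 → ClassX11 V p → X11RankZero.MissingInputAt V p) :
    BSDp W p :=
  bsdp_of_classX4M hGZK hmod hMilneC hSk hW hnf hHL hX hr
    (fun K _ _ Wd _ _ h2 hWd hmult ↦
      hK K h2 (dvd_discr_of_mult_twist hX.potMult.not_mult hX.p_ne_two K Wd hWd hmult)) hX11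

end Summit.BirchSwinnertonDyer.Rank1Residual.AdditivePotMult

end
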